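import Summits.ValiantsHypothesis.ValiantsHypothesis.Theorems.GrenetZeonDualUnipotentThreeHalvesHeavyTopTowerLemmas
import Summits.ValiantsHypothesis.ValiantsHypothesis.Theorems.GrenetZeonDualUnipotentThreeHalvesHeavyTopTowerDimension
import Summits.ValiantsHypothesis.ValiantsHypothesis.Theorems.GrenetZeonDualUnipotentThreeHalvesHeavyTopIrreducibleData

/-!
# `GrenetZeon.DualUnipotentThreeHalves` (stmt-ValiantsHypothesis-24318), R2 heavy-top instrument — COROLLARY II, the tower branch is NON-EMPTY:
# `Irr₃ = span{E₁₂+E₂₃, E₂₁−E₃₂}` is an irreducible nilpotent plane, so towers `T(p, Irr₃, q)` exist in every size `m = p + 3 + q ≥ 3`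

The extremal configurations of the codimension-one classification (★ `…HeavyTopCodimOneClassification.codimOne_classification`) that are NOT
triangularisable: for every `p, q` the tower `T(p, Irr₃, q) ≤ M_{p+3+q}(ℂ)` is a nilpotent space of dimension `C(p+3+q, 2) − 1` conjugate into `𝔫`
by no unit (✓ `Irr₃` data `irrThree_nilpotent` / `irrThree_irreducible` of `…HeavyTopIrreducibleData`; ✓ tower lemmas).

* `exists_irreducible_nilpotent_plane_three` — an irreducible nilpotent PLANE `I ≤ M₃(ℂ)` exists (`Irr₃`);
* ★ `exists_codimOne_not_triangularisable` — for all `p q`: a nilpotent `V ≤ M_{p+3+q}(ℂ)` with `dim V = C(p+3+q,2) − 1` and no unit conjugating it into `𝔫`.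

Honest framing: examples; nothing here proves or refutes `HeavyTopLaw`, 24318, S3b or 8062; `VP ≠ VNP` is NOT proved.  No definitions.
[Mathes–Omladič–Radjavi 1991 §5 (`Irr₃`); val-idea-30 MEMO codim-one §4; cell val-heavytop-census, eng-1 g5]
-/

noncomputable section

-- single-conjunct layout: Sub = Summit, duplicated namespace component intended
set_option linter.dupNamespace false

namespace Summit.ValiantsHypothesis.ValiantsHypothesis.Theorems.GrenetZeon.HeavyTopCodimOneTowersExist

open Matrix
open Summit.ValiantsHypothesis.ValiantsHypothesis.Theorems.GrenetZeon.HeavyTopTowerDefs (towerHull)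
open Summit.ValiantsHypothesis.ValiantsHypothesis.Theorems.GrenetZeon.HeavyTopTowerLemmas (isNilpotent_of_mem_towerHull not_strictUpper_conj_towerHull)
open Summit.ValiantsHypothesis.ValiantsHypothesis.Theorems.GrenetZeon.HeavyTopTowerDimension (finrank_towerHull_of_finrank_eq_two)
open Summit.ValiantsHypothesis.ValiantsHypothesis.Theorems.GrenetZeon.HeavyTopIrreducibleData (irrThree_nilpotent irrThree_irreducible)
open Literature.LinearAlgebra.Matrix (IsStrictUpper)

/-- **An irreducible nilpotent plane of `M₃(ℂ)` exists:** `Irr₃ = span{S, R}`, `S = E₁₂ + E₂₃`, `R = E₂₁ − E₃₂`. [MOR 1991 §5] -/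
theorem exists_irreducible_nilpotent_plane_three :
    ∃ I : Submodule ℂ (Matrix (Fin 3) (Fin 3) ℂ), Module.finrank ℂ I = 2 ∧ (∀ X ∈ I, IsNilpotent X) ∧
      ∀ U : Submodule ℂ (Fin 3 → ℂ), (∀ X ∈ I, ∀ x ∈ U, X *ᵥ x ∈ U) → U = ⊥ ∨ U = ⊤ := by
  classical
  let S : Matrix (Fin 3) (Fin 3) ℂ := !![0, 1, 0; 0, 0, 1; 0, 0, 0]
  let R : Matrix (Fin 3) (Fin 3) ℂ := !![0, 0, 0; 1, 0, 0; 0, -1, 0]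
  have hSR : LinearIndependent ℂ ![S, R] := by
    rw [LinearIndependent.pair_iff]
    intro s r h
    have h01 := congrFun (congrFun h 0) 1
    have h10 := congrFun (congrFun h 1) 0
    simp [S, R] at h01 h10
    exact ⟨h01, h10⟩
  refine ⟨Submodule.span ℂ {S, R}, ?_, fun X hX => ?_, fun U hU => ?_⟩
  · rw [show ({S, R} : Set (Matrix (Fin 3) (Fin 3) ℂ)) = Set.range ![S, R] by
      rw [Matrix.range_cons, Matrix.range_cons, Matrix.range_empty, Set.union_empty]; rfl, finrank_span_eq_card hSR]
    simp
  · rw [Submodule.mem_span_pair] at hX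
    obtain ⟨s, r, rfl⟩ := hX
    refine ⟨3, ?_⟩
    have h := irrThree_nilpotent s r
    have hmat : s • S + r • R = !![0, s, 0; r, 0, s; 0, -r, 0] := by
      ext i j; fin_cases i <;> fin_cases j <;> simp [S, R]
    rw [hmat]; exact h
  · exact irrThree_irreducible U (fun u hu => hU S (Submodule.subset_span (by simp)) u hu)
      (fun u hu => hU R (Submodule.subset_span (by simp)) u hu)

/-- ★ **Towers exist: non-triangularisable nilpotent spaces of codimension one in every size `p + 3 + q`.**
[val-idea-30 MEMO codim-one §4 (ii)–(iii)] -/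
theorem exists_codimOne_not_triangularisable (p q : ℕ) :
    ∃ V : Submodule ℂ (Matrix (Fin (p + 3 + q)) (Fin (p + 3 + q)) ℂ),
      (∀ A ∈ V, IsNilpotent A) ∧ Module.finrank ℂ V = (p + 3 + q).choose 2 - 1 ∧
      ¬ ∃ P : Matrix (Fin (p + 3 + q)) (Fin (p + 3 + q)) ℂ, IsUnit P ∧ ∀ A ∈ V, IsStrictUpper (P * A * P⁻¹) := by
  obtain ⟨I, hI2, hIn, hIirr⟩ := exists_irreducible_nilpotent_plane_three
  exact ⟨towerHull p q I, fun A hA => isNilpotent_of_mem_towerHull I hIn A hA, finrank_towerHull_of_finrank_eq_two p q I hI2,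
    not_strictUpper_conj_towerHull I hIirr⟩

end Summit.ValiantsHypothesis.ValiantsHypothesis.Theorems.GrenetZeon.HeavyTopCodimOneTowersExist

end
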